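/-
Copyright (c) 2026. All rights reserved.
Released under Apache 2.0 license as described in the file LICENSE.
Authors: abc-iut cell, prover seat abc-iut-w4-d095 (wave 4, gen 5), over the statements of abc-iut-L4-t3, the
reductions of abc-iut-L4-t15 / abc-iut-L4-t3 (gen 5) and the MLF model categories of abc-iut-L4-t9 (see the imports).
-/
import Literature.AnabelianGeometry.AbsoluteAnabelian.AbsTopIII.MLFGaloisMonoAnalyticization
import Literature.AnabelianGeometry.AbsoluteAnabelian.LogFrobeniusLogWallNonarchModel
import Literature.AnabelianGeometry.AbsoluteAnabelian.LogFrobeniusMonoAnalyticization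
import Literature.AnabelianGeometry.AbsoluteAnabelian.LogFrobeniusTelecoreProofs
import HarnessLib

/-!
# [AbsTopIII] Corollary 5.10 (iv)(a) AT THE MLF SETTING WITH GENUINE MONO-ANALYTIC ROWS

S. Mochizuki, *Topics in absolute anabelian geometry III: global reconstruction algorithms*, J. Math. Sci. Univ.
Tokyo 22 (2015) 939–1156 [MochizukiAbsTopIII2015]; locators = pages of the author's manuscript
(`paper:url-5493eb38cbb7`), read on the page: Def 3.1 (ii) p. 67 ("of mono-analytic type": the Galois
augmentation `Π ↠ G` is an isomorphism; the arithmetic Galois group `G` = the image of `Π → Aut(M)`), Def 3.1 (iii)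
p. 68 (`𝒞^{MLF⊢}_T`, the functors `(Π ↷ M) ↦ Π` to `𝒯𝔾`), Def 5.6 (ii) p. 135 (mono-analytic Galois-theaters
`W⊢ = (…, {(G_w, |Π|_w)}_w, …)`, (b): "`G_w` is isomorphic to the [group-theoretically characterizable — cf. Remark 1.9.2]
quotient `Π_v ↠ G_v` determined by the absolute Galois group of the base field"; the mono-analyticization functors
`Th• → Th⊢`), Def 5.6 (iii) p. 135–136 (the 1-commutative
diagram `𝒞^{MLF-sB}_{TS⊞} → 𝒞^{MLF-sB}_{TS} → 𝒯𝔾^{sB}` over `𝒞^{MLF⊢}_{TS⊞} → 𝒞^{MLF⊢}_{TS} → 𝒯𝔾⊢` whose vertical arrows are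
the mono-analyticization functors, and `𝒩⊢⊞_w`, `𝒩⊢_w` := the fibred products with `Th⊢[Z]` over `Orb(𝒯𝔾⊢)` via
`W⊢ ↦ G_w`), Prop 5.8 (vii) p. 141 (`Th⊢[Z] ≃ An⊢[𝒩⊢⊞]`, `ψ^{An⊢⊞}_{w,ν}`), Cor 5.10 p. 146 (the mono-analyticization
morphism `D•_{≥3} → D⊢` and "the various isomorphisms between composites of functors inherent in the definition of the
mono-analyticization morphism `D•_{≥3} → D⊢`"),
Cor 5.10 (iv)(a) p. 147.

## What this file does (D-0079 L-F sub-cell [AbsTop*]+[AbsAnab], row F-0138 `Cor510MonoCores`; L4-lead GO 14:22Z)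

The typed Cor 5.10 (iv)(a) `LogFrobeniusSetting.Cor510MonoCores` holds for a setting `L` EXACTLY when `V(F_mod) ≠ ∅`
and `L` carries the two printed mono-analyticization homotopies `hN` (rows 4 → 5: `𝒩_v → 𝒩⊢_v → ℰ⊢ ≅ 𝒩_v → ℰ• → ℰ⊢`)
and `hκ` (rows 6 → 7) — abc-iut-L4-t15's `cor510MonoCores_of`, abc-iut-L4-t3's `cor510MonoCores_holds` /
`MonoAnalyticizationHomotopies`, and the necessity file `LogFrobeniusMonoCoresNecessity.lean`.  The only §5 setting
in the tree with genuine components, `LogFrobeniusSetting.nonarchGenuine p` (this seat, gen 4), has its WHOLE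
mono-analytic side declared a placeholder (identities), so `hN`/`hκ` are vacuous there.  Here the mono-analytic rows
3–7 of `D⊢` are REALISED AT THE MLF MODEL by print's own constructions (`AbsTopIII/MLFGaloisMonoAnalyticization.lean`,
this seat: `TSObj.monoAn` = the mono-analyticization of `TS`-pairs `(Π ↷ M) ↦ (G ↷ M)`, `G` the arithmetic Galois
group, Def 5.6 (iii) / Def 3.1 (ii); `TFModel.monoGal` = `W ↦ G_w` at an MLF, `(Π_k ↠ G_k ↷ ℚ̄_p) ↦ Π_k/Ker(ε_k)`,
Def 5.6 (ii)(b)):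

* the setting `LogFrobeniusSetting.nonarchGenuineMono p Vmod isArc` := `nonarchGenuine p` (holomorphic rows 1–4
  GENUINE at nonarchimedean places: `𝒳 = Up (TFModel p)`, `𝒩⊞_v = 𝒩_v = 𝒳 × 𝒞_TS`, `λ⊞ = (𝟭, λ_ν)`, `ι⊞ = (𝟙, ι_ε)`;
  `ℰ• := 𝒳`, `An• := 𝒳` placeholders as before) with the mono-analytic side REPLACED by: `ℰ⊢ := Up 𝒯𝔾`
  (abc-iut-L4-t9's double-underlined `TopGroupObj`), `ℰ• → ℰ⊢ := monoGal`, `𝒩⊢⊞_w = 𝒩⊢_w := ℰ⊢ × 𝒞_TS` (print's fibred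
  product over `Orb(𝒯𝔾⊢)` relaxed to a product, exactly as on the holomorphic side of `nonarchGenuine`),
  `𝒩⊞_v → 𝒩⊢⊞_v`, `𝒩_v → 𝒩⊢_v := monoGal × TSObj.monoAn` (componentwise mono-analyticization), `𝒩⊢_w → ℰ⊢ := pr₁`,
  `An⊢[𝒩⊢⊞] := ℰ⊢` with `κ_{An⊢}` the identity equivalence (the trivial model of the Prop 5.8 (vii) equivalence) and
  `ψ^{An⊢⊞}_{w,ν} := G ↦ (G, (G ↷ pt))` (`TopGroupObj.trivialTS`) — PLACEHOLDER for the forgetful functors from the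
  mono-anabelian containers `G ↷ 𝒪^×(G)`, `G ↷ k~(G)` of Prop 5.8 (i)–(iii), whose construction is local class field
  theory (FACT-LIST); Cor 5.10 (iv)(a) reads no telecore edge, so this placeholder is idle below (honest label).

THEOREMS: at `nonarchGenuineMono p Vmod isArc` the rows-4→5 square commutes ON THE NOSE for every `v`
(`nonarchGenuineMono_monoN_toEmono_eq`) — it is the defining square of the (relaxed) fibred product — and so does the
rows-6→7 square; hence `MonoAnalyticizationHomotopies` is INHABITED by canonical identifications
(`nonarchGenuineMono_monoAnalyticizationHomotopies`), and **Cor 5.10 (iv)(a) holds at this setting for every index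
set with a place, with ZERO `Prop` binders** (`nonarchGenuineMono_cor510MonoCores`; `↔ Nonempty Vmod`,
`nonarchGenuineMono_cor510MonoCores_iff`).  The holomorphic-side results of `nonarchGenuine p` persist at the same
setting (Cor 5.5 (iv) sentences 1–2, Cor 5.5 (iii) `⊞`-half, Cor 5.5 (i)–(ii): Part 3), so ONE setting now carries
Cor 5.5 (i)–(iv) and Cor 5.10 (iv)(a).  (Doc-only v2: quotations restored to print's wording — brackets kept, no
silent elisions — after referee lane L12's n26 style ruling; declarations byte-identical.)  MODEL-LEVEL (honest framing): the global theaters `Th•[Z]`, `Th⊢[Z]` of an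
elliptically admissible orbicurve and the Prop 5.8 containers are campaign-L constructions; nothing here bears on
[IUTchIII] Cor. 3.12; no side taken; typed ≠ proved; model-level ≠ node-level.
-/

set_option autoImplicit false

noncomputable section

open CategoryTheory Topology

namespace Literature.AnabelianGeometry.AbsoluteAnabelian

/-! ## Part 1. The §5 setting with genuine nonarchimedean AND genuine mono-analytic rows -/

namespace LogFrobeniusSetting

open AbsTopIII

variable (p : ℕ) [Fact p.Prime]

/-- **The mono-analyticization `𝒩_v → 𝒩⊢_v` (and `𝒩⊞_v → 𝒩⊢⊞_v`) at the model**: componentwise on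
`𝒩_v = 𝒳 × 𝒞_TS`, the base by `W ↦ G_w` (`TFModel.monoGal`) and the local `TS`-pair by `(Π ↷ M) ↦ (G ↷ M)`
(`TSObj.monoAn`) — the vertical arrows of Def 5.6 (iii) after the (relaxed) fibred product with `Th• → Th⊢`.
[cite: MochizukiAbsTopIII2015, Definition 5.6 (iii) p.136] -/
def nonarchMonoN : Up (TFModel p × TSObj) ⥤ Up (TopGroupObj × TSObj) :=
  Up.liftF ((TFModel.monoGal p).prod TSObj.monoAn)

/-- **The global log-Frobenius setting with GENUINE NONARCHIMEDEAN COMPONENTS AND GENUINE MONO-ANALYTIC ROWS** (module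
docstring): rows 1–4 and the placeholders `ℰ• := 𝒳`, `An• := 𝒳` exactly as in `nonarchGenuine p`; mono-analytic side
`ℰ⊢ := Up 𝒯𝔾`, `ℰ• → ℰ⊢ := monoGal`, `𝒩⊢⊞_w = 𝒩⊢_w := ℰ⊢ × 𝒞_TS`, `𝒩_v → 𝒩⊢_v := monoGal × monoAn`, `𝒩⊢_w → ℰ⊢ := pr₁`,
`An⊢ := ℰ⊢` (`κ_{An⊢} = id`), `ψ^{An⊢⊞}_{w,ν} := G ↦ (G, (G ↷ pt))` (PLACEHOLDER, idle for Cor 5.10 (iv)(a)).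
[cite: MochizukiAbsTopIII2015, Definition 5.6 (iii) p.136] -/
def nonarchGenuineMono (Vmod : Type 1) (isArc : Vmod → Bool) : LogFrobeniusSetting Vmod isArc where
  X := Up (TFModel p)
  E := Up (TFModel p)
  proj := 𝟭 _
  log := 𝟭 _
  logIsoId := Iso.refl _
  logOver := Iso.refl _
  Nplus _ := Up (TFModel p × TSObj)
  N _ := Up (TFModel p × TSObj)
  forget _ := 𝟭 _
  toE _ := Up.liftF (CategoryTheory.Prod.fst (TFModel p) TSObj)
  lam v := nonarchLam p (isArc v)
  lamOver v := nonarchLamOver p (isArc v)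
  lam_spaceLink_eq_postLog v := nonarchLam_spaceLink_eq_postLog p (isArc v)
  iota v _ _ ε := nonarchIota p (isArc v) ε
  An := Up (TFModel p)
  κAn := CategoryTheory.Equivalence.refl
  φAn := 𝟭 _
  φAn_isEquivalence := inferInstance
  ηAn := Iso.refl _
  κAn₂ := CategoryTheory.Equivalence.refl
  Emono := Up TopGroupObj
  monoAn := Up.liftF (TFModel.monoGal p)
  NmonoPlus _ := Up (TopGroupObj × TSObj)
  Nmono _ := Up (TopGroupObj × TSObj)
  forgetMono _ := 𝟭 _
  toEmono _ := Up.liftF (CategoryTheory.Prod.fst TopGroupObj TSObj)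
  monoNplus _ := nonarchMonoN p
  monoN _ := nonarchMonoN p
  monoHomotopy _ := Iso.refl _
  AnMono := Up TopGroupObj
  κAnMono := CategoryTheory.Equivalence.refl
  ψAnMono _ _ := Up.liftF ((𝟭 TopGroupObj).prod' TopGroupObj.trivialTS)

/-- The `TS`-valued homotopy datum of the setting (all six arrows of Def 5.4 (iii) at the MLF model, as for
`nonarchGenuine p`). [cite: MochizukiAbsTopIII2015, Definition 5.4 (vii) p.128] -/
def nonarchGenuineMonoTS (Vmod : Type 1) (isArc : Vmod → Bool) : (nonarchGenuineMono p Vmod isArc).TSHomotopies where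
  iota v _ _ ε := nonarchIotaTS p (isArc v) ε
  iota_toTS v _ _ ε := nonarchIotaTS_toTS p (isArc v) ε

variable (Vmod : Type 1) (isArc : Vmod → Bool)

/-- The holomorphic rows of the new setting ARE those of `nonarchGenuine p` (same `𝒳`, `𝒩⊞_v`, `λ⊞`, `ι⊞`).
[cite: MochizukiAbsTopIII2015, Definition 5.4 (iv) p.127] -/
theorem nonarchGenuineMono_holomorphic_eq :
    (nonarchGenuineMono p Vmod isArc).X = (nonarchGenuine p Vmod isArc).X ∧
      (nonarchGenuineMono p Vmod isArc).Nplus = (nonarchGenuine p Vmod isArc).Nplus ∧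
      HEq (nonarchGenuineMono p Vmod isArc).lam (nonarchGenuine p Vmod isArc).lam ∧
      HEq (fun v ν₁ ν₂ ε => (nonarchGenuineMono p Vmod isArc).iota v (ν₁ := ν₁) (ν₂ := ν₂) ε)
        (fun v ν₁ ν₂ ε => (nonarchGenuine p Vmod isArc).iota v (ν₁ := ν₁) (ν₂ := ν₂) ε) :=
  ⟨rfl, rfl, HEq.rfl, HEq.rfl⟩

/-- The mono-analytic base of the new setting is the category of topological groups `Up 𝒯𝔾`, reached from `ℰ•` by
`W ↦ G_w` (NOT a placeholder). [cite: MochizukiAbsTopIII2015, Definition 5.6 (ii) p.135] -/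
theorem nonarchGenuineMono_monoAn_eq :
    (nonarchGenuineMono p Vmod isArc).Emono = Up TopGroupObj ∧
      (nonarchGenuineMono p Vmod isArc).monoAn = Up.liftF (TFModel.monoGal p) := ⟨rfl, rfl⟩

/-! ## Part 2. The mono-analyticization homotopies hold on the nose; Cor 5.10 (iv)(a) at the setting -/

/-- **rows 4 → 5 (`hN`) ON THE NOSE**: the two length-2 paths `𝒩_v → 𝒩⊢_v → ℰ⊢` and `𝒩_v → ℰ• → ℰ⊢` realise THE SAME
functor `(A, (Π ↷ M)) ↦ G_A` — the defining square of the (relaxed) fibred product `𝒩⊢_v = Orb(𝒞^{MLF⊢}_{TS}) ×_{𝒯𝔾⊢} Th⊢[Z]`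
of Def 5.6 (iii). [cite: MochizukiAbsTopIII2015, Cor 5.10 p. 146] -/
theorem nonarchGenuineMono_monoN_toEmono_eq (v : Vmod) :
    (nonarchGenuineMono p Vmod isArc).monoN v ⋙ (nonarchGenuineMono p Vmod isArc).toEmono v =
      (nonarchGenuineMono p Vmod isArc).toE v ⋙ (nonarchGenuineMono p Vmod isArc).monoAn := rfl

/-- **rows 6 → 7 (`hκ`) ON THE NOSE**: `(An•[𝒳] ⥲ ℰ•) → ℰ⊢` and `κ_{An•}⁻¹ ⋙ (ℰ• → ℰ⊢)` coincide (the `An•` placeholders are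
identities; the mono-analyticization is the genuine `monoGal` on both paths). [cite: MochizukiAbsTopIII2015, Cor 5.10 p. 146] -/
theorem nonarchGenuineMono_κAn₂_monoAn_eq :
    (nonarchGenuineMono p Vmod isArc).κAn₂.functor ⋙ (nonarchGenuineMono p Vmod isArc).monoAn =
      (nonarchGenuineMono p Vmod isArc).κAn.inverse ⋙ (nonarchGenuineMono p Vmod isArc).monoAn := rfl

/-- **The mono-analyticization homotopies of Cor 5.10 (abc-iut-L4-t3's add-on `MonoAnalyticizationHomotopies`) are
INHABITED at the setting by canonical identifications** — `hN`, `hκ` DISCHARGED at the MLF model with genuine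
mono-analytic rows. [cite: MochizukiAbsTopIII2015, Cor 5.10 p. 146] -/
def nonarchGenuineMono_monoAnalyticizationHomotopies :
    (nonarchGenuineMono p Vmod isArc).MonoAnalyticizationHomotopies where
  toE v := eqToIso (nonarchGenuineMono_monoN_toEmono_eq p Vmod isArc v)
  anToE := Iso.refl _

/-- abc-iut-L4-t15's two inputs `hN`, `hκ` of `cor510MonoCores_of`, discharged at the setting.
[cite: MochizukiAbsTopIII2015, Cor 5.10 (iv)(a) p.147] -/
theorem nonarchGenuineMono_hN_hκ :
    (∀ v : Vmod, Nonempty ((nonarchGenuineMono p Vmod isArc).monoN v ⋙ (nonarchGenuineMono p Vmod isArc).toEmono v ≅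
      (nonarchGenuineMono p Vmod isArc).toE v ⋙ (nonarchGenuineMono p Vmod isArc).monoAn)) ∧
    Nonempty ((nonarchGenuineMono p Vmod isArc).κAn₂.functor ⋙ (nonarchGenuineMono p Vmod isArc).monoAn ≅
      (nonarchGenuineMono p Vmod isArc).κAn.inverse ⋙ (nonarchGenuineMono p Vmod isArc).monoAn) :=
  ⟨fun v => ⟨(nonarchGenuineMono_monoAnalyticizationHomotopies p Vmod isArc).toE v⟩,
    ⟨(nonarchGenuineMono_monoAnalyticizationHomotopies p Vmod isArc).anToE'⟩⟩

/-- **[AbsTopIII] Cor 5.10 (iv)(a) (Mono-analytic Cores) HOLDS at the MLF setting with genuine nonarchimedean and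
genuine mono-analytic rows**, for every index set with a place: "for `n = 5, 6, 7`, `D•⊢_{≤n}` admits a natural structure
of core on the subdiagram of categories of `D•⊢` determined by the union `D•⊢_{≤n-1} ∪ D•_{≤n}` — i.e., loosely speaking,
`ℰ⊢`, `An⊢[𝒩⊢⊞]` “form cores” of the functors in `D•⊢`" (here `ℰ⊢ = Up 𝒯𝔾`) — with ZERO `Prop`
binders (FACT-LIST F-0138's named instance at the genuine carrier; abc-iut-L4-t15's `cor510MonoCores_of` fed with
the discharged `hN`, `hκ`).  MODEL-LEVEL. [cite: MochizukiAbsTopIII2015, Cor 5.10 (iv)(a) p.147] -/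
theorem nonarchGenuineMono_cor510MonoCores [Nonempty Vmod] : (nonarchGenuineMono p Vmod isArc).Cor510MonoCores :=
  (nonarchGenuineMono p Vmod isArc).cor510MonoCores_of (nonarchGenuineMono_hN_hκ p Vmod isArc).1
    (nonarchGenuineMono_hN_hκ p Vmod isArc).2

/-- The same through abc-iut-L4-t3's `cor510MonoCores_holds` over the inhabited add-on.
[cite: MochizukiAbsTopIII2015, Cor 5.10 (iv)(a) p.147] -/
theorem nonarchGenuineMono_cor510MonoCores' [Nonempty Vmod] : (nonarchGenuineMono p Vmod isArc).Cor510MonoCores :=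
  cor510MonoCores_holds (nonarchGenuineMono_monoAnalyticizationHomotopies p Vmod isArc)

/-- At this setting the typed Cor 5.10 (iv)(a) holds EXACTLY when the index set is nonempty (the degenerate corner
`V(F_mod) = ∅` is abc-iut-L4-t15's `not_cor510MonoCores_of_isEmpty`). [cite: MochizukiAbsTopIII2015, Cor 5.10 (iv)(a) p.147] -/
theorem nonarchGenuineMono_cor510MonoCores_iff :
    (nonarchGenuineMono p Vmod isArc).Cor510MonoCores ↔ Nonempty Vmod :=
  cor510MonoCores_iff_nonempty (nonarchGenuineMono_monoAnalyticizationHomotopies p Vmod isArc)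

/-- Existence form for the FACT-LIST row F-0138: over every nonempty index set (universe `1`) there is a §5 setting
whose mono-analytic base is the category of topological groups `Up 𝒯𝔾`, reached by the genuine `W ↦ G_w`, at which
`Cor510MonoCores` holds. [cite: MochizukiAbsTopIII2015, Cor 5.10 (iv)(a) p.147] -/
theorem exists_cor510MonoCores_genuineMono [Nonempty Vmod] :
    ∃ L : LogFrobeniusSetting Vmod isArc,
      L.Emono = Up TopGroupObj ∧ L.monoAn ≍ Up.liftF (TFModel.monoGal p) ∧ L.Cor510MonoCores :=
  ⟨nonarchGenuineMono p Vmod isArc, rfl, HEq.rfl, nonarchGenuineMono_cor510MonoCores p Vmod isArc⟩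

/-! ## Part 3. The holomorphic-side results of `nonarchGenuine p` persist at the new setting -/

/-- **Cor 5.5 (iv), print-faithful sentences 1 and 2, HOLD at the new setting** (same genuine nonarchimedean arrows:
`𝒪^× ↪ k̄^× ↪ k̄`, `k~ →(id) k~` injective, `log_k̄` not — this seat's gen-4 mechanism, unchanged).
[cite: MochizukiAbsTopIII2015, Cor 5.5 (iv) p. 131] -/
theorem nonarchGenuineMono_cor55LogWall_and_notSimCompat (v₀ : Vmod) (hv₀ : isArc v₀ = false)
    (x₀ : Up (TFModel p)) :
    (nonarchGenuineMono p Vmod isArc).Cor55LogWall (nonarchGenuineMonoTS p Vmod isArc) ∧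
      (nonarchGenuineMono p Vmod isArc).Cor55NotSimultaneouslyCompatible (nonarchGenuineMonoTS p Vmod isArc) :=
  (nonarchGenuineMono p Vmod isArc).cor55LogWall_and_notSimCompat_of_iota_injective (nonarchGenuineMonoTS p Vmod isArc)
    v₀ hv₀ x₀ (nonarchΨ p)
    (fun νu νm νc _ _ _ ε₁ ε₂ ε₃ ε₄ => nonarchIotaTS_twoPath p (isArc v₀) hv₀ νu νm νc ε₁ ε₂ ε₃ ε₄ x₀)

/-- **Cor 5.5 (iii), `⊞`-half, HOLDS at the new setting** (the `ι⊞`-squares of Def 5.4 (iii) commute at the MLF model).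
[cite: MochizukiAbsTopIII2015, Cor 5.5 (iii) p. 131] -/
theorem nonarchGenuineMono_cor55Observables : (nonarchGenuineMono p Vmod isArc).Cor55Observables :=
  (nonarchGenuineMono p Vmod isArc).cor55Observables_of_iotaSquaresCommute
    (nonarchGenuine_iotaSquaresCommute p Vmod isArc)

/-- **Cor 5.5 (i), (ii) at the new setting** (the universal `cor55Cores_holds` / `cor55Telecore_holds` of abc-iut-L4-t12 /
abc-iut-L4-t15; recorded so that ONE setting carries Cor 5.5 (i)–(iv) and Cor 5.10 (iv)(a) together).
[cite: MochizukiAbsTopIII2015, Cor 5.5 (i) p. 130] -/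
theorem nonarchGenuineMono_cor55Cores_and_telecore [Nonempty Vmod] :
    (nonarchGenuineMono p Vmod isArc).Cor55Cores ∧ (nonarchGenuineMono p Vmod isArc).Cor55Telecore :=
  ⟨(nonarchGenuineMono p Vmod isArc).cor55Cores_holds, (nonarchGenuineMono p Vmod isArc).cor55Telecore_holds⟩

end LogFrobeniusSetting

end Literature.AnabelianGeometry.AbsoluteAnabelian

end
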